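import Summits.QuantumFields.QCD.Theses.PauliWegnerSea
import Literature.MathematicalPhysics.QuantumFieldTheory.QCDCurrentSector
import Literature.MathematicalPhysics.QuantumFieldTheory.QCDTimeReflection
import Summits.QuantumFields.QCD.Theorems.SpectralDefectExtinctionWindowExtinctionChessboardTransferFragments
import Literature.MathematicalPhysics.QuantumFieldTheory.QCDSiteReflectionPositivityProofs
import Literature.MathematicalPhysics.QuantumFieldTheory.QCDTimeReflectionProofs
import Summits.QuantumFields.QCD.Theorems.PauliWegnerSeaChiralOneScaleTrajectoryStubTransferPositivityObs
import Summits.QuantumFields.QCD.Theorems.PauliWegnerSeaChiralOneScaleTrajectoryStubTransferPositivityGram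

/-!
# Transfer positivity in RP–Hankel form (crux `PauliWegnerSea.ChiralOneScaleTrajectory`, stmt-QuantumFields-17512,
line `log-convex-continuum-lift`, registered stub `stub_transferPositivity` of skeleton v2
`Cruxes/ChiralOneScaleTrajectory/Lines/log_convex_continuum_lift.lean`)

**What is proved.** `stub_transferPositivity : ∀ Nf, APTI⟪Nf⟫ → TP⟪Nf⟫`: assuming translation invariance of the
un-normalised antiperiodic two-bilinear functional (Stub 1, hypothesis), for `β ≥ 0`, `S ≥ 1`, masses `m_f > −1` and
flavours `f, g` there is a unit complex phase `u` (depending only on `N_f` and `S`: `u = −conj c₀/‖c₀‖` with `c₀` the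
universal constant `posConst` of the landed odd-torus site-reflection positivity) such that, for every real profile `h`
on a finite set `T` of spatial sites in the box of radius `S` and all `1 ≤ s, t ≤ S`,
(G1) `0 ≤ u·𝒟_h(2s)`, (G2) `‖𝒟_h(s+t)‖² ≤ Re(u𝒟_h(2s))·Re(u𝒟_h(2t))`, and (G3) `‖N_AP(2t e₀ + w)‖ ≤ Re(u N_AP(2t e₀))`
for spatial `w` in the box — `N_AP` the un-normalised flavoured pion numerator, `𝒟_h` its source-and-sink smearing.

**How.** DERIVED from the landed `posConst_mul_conj_integral_nonneg` (the un-normalised form of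
`WilsonQCDSiteReflectionPositivityAP_holds`; Montvay–Münster 1994 §4.2.3 (4.90)–(4.110), Lüscher 1977, Osterwalder–Seiler
1978): `0 ≤ c₀ · conj ∫∫ A (ΘA) e^{AP}` for positive-time gauge-invariant local observables `A`.  Applied to the
U-independent observables `α X_s + β' X_t`, `X_s = Σ_{z∈T} h(z) (ψ̄_f γ₅ ψ_g)(s e₀ + z)` (box radius `S`, times `≥ 1`,
empty link support), the sesquilinear expansion gives a non-negative `2 × 2` Gram form whose entries are
`Q(X_i, X_j) = ∫∫ X_i Θ_T(X_j) e^{AP}`; the reflection `Θ_T(ψ̄_f γ₅ ψ_g)(y) = −(ψ̄_g γ₅ ψ_f)(θy)` (`γ₀γ₅γ₀ = −γ₅`), centrality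
of even Grassmann elements and the translation hypothesis identify `Q(X_s, X_t) = −𝒟_h(s+t)`; Gram positivity
(`|b|² ≤ ad`) gives (G1)–(G2), and the same argument for the two point densities at `(t, 0)`, `(t, w)` gives (G3).
Helpers: `…StubTransferPositivityObs` (torus bilinears, RP positivity for constants, integrability),
`…StubTransferPositivityGram` (Gram positivity, the reflected pairing, the smeared Gram form).
-/

noncomputable section

-- keep this namespace prefix; the LAST component is yours (one sub-namespace per stub file)
namespace Summit.QuantumFields.QCD.Cruxes.ChiralOneScaleTrajectory.LogConvexLift.TransferPositivity

open scoped BigOperators Topology ComplexOrder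
open MeasureTheory Filter
open Literature.MathematicalPhysics.QuantumFieldTheory Literature.MathematicalPhysics.QuantumLattice
  Literature.Probability.LatticeModels

/-! ### NOTATION PRELUDE (paste verbatim into every stub work file; expands to tree declarations only)

* `nAP⟪β, S, mq, f, g, v⟫` — UN-normalised antiperiodic flavoured pion numerator on the torus of side `2S+1`:
  `∫dμ_W(β) ∫dψ̄dψ (ψ̄_g γ₅ ψ_f)(0) · (ψ̄_f γ₅ ψ_g)(v) · e^{−ψ̄ D_AP(U) ψ}` (`v : Site 4`, read mod `2S+1`);
* `nP⟪…⟫` — the same with the Statement's time-PERIODIC `fermiBoltzmann`;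
* `zAP⟪β, S, mq⟫`, `zP⟪β, S, mq⟫` — the two partition functions;
* `dAP⟪β, S, mq, f, g, T, h, n⟫` — the source-and-sink smeared trace `𝒟_h(n) = Σ_{z,z' ∈ T} h z h z' N_AP(n e₀ + z' − z)`
  for a real profile `h` on the finite set `T` of (spatial) sites;
* `APTI⟪Nf⟫`, `TP⟪Nf⟫`, `CHORD`, `LOGROOM⟪reg⟫`, `TWIST⟪Nf, reg⟫`, `LIGHT⟪Nf, reg⟫` — the Props of the stubs. -/

local notation "SU3" => Matrix.specialUnitaryGroup (Fin 3) ℂ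

local notation "nAP⟪" β ", " S ", " mq ", " f ", " g ", " v "⟫" =>
  (∫ U : GaugeConfig 4 (2 * S + 1) (Matrix.specialUnitaryGroup (Fin 3) ℂ),
      fermiIntegral (torusBilinear g f (Torus.proj (2 * S + 1) 0) (Torus.proj (2 * S + 1) 0) gammaFive 1 *
          torusBilinear f g (Torus.proj (2 * S + 1) v) (Torus.proj (2 * S + 1) v) gammaFive 1 *
        fermiBoltzmannAP U mq)
    ∂(wilsonMeasure (fundamentalRep (Fin 3)) β))

local notation "nP⟪" β ", " S ", " mq ", " f ", " g ", " v "⟫" =>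
  (∫ U : GaugeConfig 4 (2 * S + 1) (Matrix.specialUnitaryGroup (Fin 3) ℂ),
      fermiIntegral (torusBilinear g f (Torus.proj (2 * S + 1) 0) (Torus.proj (2 * S + 1) 0) gammaFive 1 *
          torusBilinear f g (Torus.proj (2 * S + 1) v) (Torus.proj (2 * S + 1) v) gammaFive 1 *
        fermiBoltzmann U mq)
    ∂(wilsonMeasure (fundamentalRep (Fin 3)) β))

local notation "zAP⟪" β ", " S ", " mq "⟫" =>
  (∫ U : GaugeConfig 4 (2 * S + 1) (Matrix.specialUnitaryGroup (Fin 3) ℂ),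
      fermiIntegral (fermiBoltzmannAP U mq) ∂(wilsonMeasure (fundamentalRep (Fin 3)) β))

local notation "zP⟪" β ", " S ", " mq "⟫" =>
  (∫ U : GaugeConfig 4 (2 * S + 1) (Matrix.specialUnitaryGroup (Fin 3) ℂ),
      fermiIntegral (fermiBoltzmann U mq) ∂(wilsonMeasure (fundamentalRep (Fin 3)) β))

local notation "dAP⟪" β ", " S ", " mq ", " f ", " g ", " T ", " h ", " n "⟫" =>
  (∑ z ∈ (T : Finset (Literature.Probability.LatticeModels.Site 4)),
    ∑ z' ∈ (T : Finset (Literature.Probability.LatticeModels.Site 4)),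
      (((h : Literature.Probability.LatticeModels.Site 4 → ℝ) z * h z' : ℝ) : ℂ) *
        nAP⟪β, S, mq, f, g, (Pi.single (0 : Fin 4) (((n : ℕ) : ℤ)) + (z' - z))⟫)

-- `APTI⟪Nf⟫`: translation invariance of the un-normalised antiperiodic two-bilinear functional.
set_option quotPrecheck false in
local notation "APTI⟪" Nf "⟫" =>
  (∀ (β : ℝ) (S : ℕ) (mq : Fin Nf → ℝ) (f g f' g' : Fin Nf) (Γ Γ' : Matrix (Fin 4) (Fin 4) ℂ)
      (x y u : TorusSite 4 (2 * S + 1)),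
    (∫ U : GaugeConfig 4 (2 * S + 1) (Matrix.specialUnitaryGroup (Fin 3) ℂ),
        fermiIntegral (torusBilinear f g x x Γ 1 * torusBilinear f' g' y y Γ' 1 * fermiBoltzmannAP U mq)
      ∂(wilsonMeasure (fundamentalRep (Fin 3)) β)) =
    ∫ U : GaugeConfig 4 (2 * S + 1) (Matrix.specialUnitaryGroup (Fin 3) ℂ),
        fermiIntegral (torusBilinear f g (x + u) (x + u) Γ 1 * torusBilinear f' g' (y + u) (y + u) Γ' 1 *
          fermiBoltzmannAP U mq)
      ∂(wilsonMeasure (fundamentalRep (Fin 3)) β))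

-- `TP⟪Nf⟫`: the RP–Hankel form of transfer positivity (even separations, phase `u`).
set_option quotPrecheck false in
local notation "TP⟪" Nf "⟫" =>
  (∀ (β : ℝ), 0 ≤ β → ∀ (S : ℕ), 1 ≤ S → ∀ (mq : Fin Nf → ℝ), (∀ fl, -1 < mq fl) → ∀ (f g : Fin Nf),
    ∃ u : ℂ, ‖u‖ = 1 ∧
      (∀ (T : Finset (Literature.Probability.LatticeModels.Site 4)) (h : Literature.Probability.LatticeModels.Site 4 → ℝ),
        (∀ z ∈ T, z 0 = 0 ∧ ∀ i, |z i| ≤ (S : ℤ)) →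
        ∀ (s t : ℕ), 1 ≤ s → s ≤ S → 1 ≤ t → t ≤ S →
          0 ≤ u * dAP⟪β, S, mq, f, g, T, h, 2 * s⟫ ∧
          ‖dAP⟪β, S, mq, f, g, T, h, s + t⟫‖ ^ 2 ≤
            (u * dAP⟪β, S, mq, f, g, T, h, 2 * s⟫).re * (u * dAP⟪β, S, mq, f, g, T, h, 2 * t⟫).re) ∧
      (∀ (t : ℕ) (w : Literature.Probability.LatticeModels.Site 4), 1 ≤ t → t ≤ S → w 0 = 0 →
        (∀ i, |w i| ≤ (S : ℤ)) →
          ‖nAP⟪β, S, mq, f, g, (Pi.single (0 : Fin 4) (((2 * t : ℕ) : ℤ)) + w)⟫‖ ≤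
            (u * nAP⟪β, S, mq, f, g, (Pi.single (0 : Fin 4) (((2 * t : ℕ) : ℤ)))⟫).re))

-- `CHORD`: local log-convexity of a non-negative finite sequence gives the three-point chord inequality.
set_option quotPrecheck false in
local notation "CHORD" =>
  (∀ (e : ℕ → ℝ) (N : ℕ), (∀ j, 1 ≤ j → j ≤ N → 0 ≤ e j) →
    (∀ j, 2 ≤ j → j + 1 ≤ N → e j ^ 2 ≤ e (j - 1) * e (j + 1)) →
    ∀ i j k : ℕ, 1 ≤ i → i < j → j < k → k ≤ N → e j ^ (k - i) ≤ e i ^ (k - j) * e k ^ (j - i))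

-- `LOGROOM⟪reg⟫`: superlogarithmic physical volume.
set_option quotPrecheck false in
local notation "LOGROOM⟪" reg "⟫" =>
  (Tendsto (fun k => QCDRegularisation.a reg k * (QCDRegularisation.L reg k : ℝ) /
    (1 + |Real.log (QCDRegularisation.a reg k)|)) atTop atTop)

-- `TWIST⟪Nf, reg⟫`: the `(−1)^F` twist is invisible at log-scale separations, at `S = L_k`, eventually.
set_option quotPrecheck false in
local notation "TWIST⟪" Nf ", " reg "⟫" =>
  (∀ (m : Fin Nf → ℝ), (∀ fl, 0 < m fl) → ∀ (f g : Fin Nf), f ≠ g → ∀ K : ℝ, ∀ᶠ k in atTop,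
    2 * ‖zAP⟪QCDRegularisation.β reg k, QCDRegularisation.L reg k,
            fun fl => QCDRegularisation.mcrit reg k + QCDRegularisation.a reg k * m fl / QCDRegularisation.Zm reg k⟫ -
          zP⟪QCDRegularisation.β reg k, QCDRegularisation.L reg k,
            fun fl => QCDRegularisation.mcrit reg k + QCDRegularisation.a reg k * m fl / QCDRegularisation.Zm reg k⟫‖ ≤
      ‖zAP⟪QCDRegularisation.β reg k, QCDRegularisation.L reg k,
          fun fl => QCDRegularisation.mcrit reg k + QCDRegularisation.a reg k * m fl / QCDRegularisation.Zm reg k⟫‖ ∧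
    ∀ n : ℕ, (n : ℝ) * QCDRegularisation.a reg k ≤ K * (1 + |Real.log (QCDRegularisation.a reg k)|) →
      2 * ‖nAP⟪QCDRegularisation.β reg k, QCDRegularisation.L reg k,
              fun fl => QCDRegularisation.mcrit reg k + QCDRegularisation.a reg k * m fl / QCDRegularisation.Zm reg k,
              f, g, (Pi.single (0 : Fin 4) ((n : ℕ) : ℤ))⟫ -
            nP⟪QCDRegularisation.β reg k, QCDRegularisation.L reg k,
              fun fl => QCDRegularisation.mcrit reg k + QCDRegularisation.a reg k * m fl / QCDRegularisation.Zm reg k,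
              f, g, (Pi.single (0 : Fin 4) ((n : ℕ) : ℤ))⟫‖ ≤
        ‖nAP⟪QCDRegularisation.β reg k, QCDRegularisation.L reg k,
            fun fl => QCDRegularisation.mcrit reg k + QCDRegularisation.a reg k * m fl / QCDRegularisation.Zm reg k,
            f, g, (Pi.single (0 : Fin 4) ((n : ℕ) : ℤ))⟫‖)

-- `LIGHT⟪Nf, reg⟫`: LatticeLightness at EVEN lattice times `2n₁ < 2n₂` within a fixed physical distance, with a
-- polynomial floor relative to `‖Z_AP‖ > 0`, frequently in `k`, at `S = L_k`.
set_option quotPrecheck false in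
local notation "LIGHT⟪" Nf ", " reg "⟫" =>
  (∀ ε : ℝ, 0 < ε → ∃ m : Fin Nf → ℝ, (∀ fl, 0 < m fl) ∧ ∃ (f g : Fin Nf), f ≠ g ∧
    ∃ (R : ℝ) (p : ℕ) (C : ℝ), 0 < C ∧ ∃ᶠ k in atTop,
      ∃ (T : Finset (Literature.Probability.LatticeModels.Site 4)) (h : Literature.Probability.LatticeModels.Site 4 → ℝ)
        (n₁ n₂ : ℕ),
        1 ≤ n₁ ∧ n₁ < n₂ ∧ (n₂ : ℝ) * QCDRegularisation.a reg k ≤ R ∧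
        (∀ z ∈ T, z 0 = 0 ∧ ∀ i, |z i| ≤ (n₂ : ℤ)) ∧
        0 < ∑ z ∈ T, |h z| ∧
        0 < ‖zAP⟪QCDRegularisation.β reg k, QCDRegularisation.L reg k,
              fun fl => QCDRegularisation.mcrit reg k + QCDRegularisation.a reg k * m fl / QCDRegularisation.Zm reg k⟫‖ ∧
        C * QCDRegularisation.a reg k ^ p * ((∑ z ∈ T, |h z|) ^ 2 *
            ‖zAP⟪QCDRegularisation.β reg k, QCDRegularisation.L reg k,
              fun fl => QCDRegularisation.mcrit reg k + QCDRegularisation.a reg k * m fl / QCDRegularisation.Zm reg k⟫‖) ≤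
          ‖dAP⟪QCDRegularisation.β reg k, QCDRegularisation.L reg k,
              fun fl => QCDRegularisation.mcrit reg k + QCDRegularisation.a reg k * m fl / QCDRegularisation.Zm reg k,
              f, g, T, h, 2 * n₂⟫‖ ∧
        ‖dAP⟪QCDRegularisation.β reg k, QCDRegularisation.L reg k,
            fun fl => QCDRegularisation.mcrit reg k + QCDRegularisation.a reg k * m fl / QCDRegularisation.Zm reg k,
            f, g, T, h, 2 * n₁⟫‖ ≤
          ‖dAP⟪QCDRegularisation.β reg k, QCDRegularisation.L reg k,
              fun fl => QCDRegularisation.mcrit reg k + QCDRegularisation.a reg k * m fl / QCDRegularisation.Zm reg k,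
              f, g, T, h, 2 * n₂⟫‖ * Real.exp (ε * (QCDRegularisation.a reg k * ((n₂ : ℝ) - n₁))))

/-! ### (end of NOTATION PRELUDE — statements below must use these notations verbatim) -/

open scoped ComplexConjugate

/-- **Stub 2 · transfer positivity, RP–Hankel form** (from the LANDED `WilsonQCDSiteReflectionPositivityAP_holds`,
un-normalised version `posConst_mul_conj_integral_nonneg` with the universal phase `posConst`, applied to the
two-dimensional spans of positive-time smeared pseudoscalars `X_s = Σ_{z∈T} h(z) (ψ̄_f γ₅ ψ_g)(s e₀ + z)`,
`1 ≤ s ≤ S`, box radius `S`; the Gram matrix is `η·𝒟_h(s+t)` after Stub 1, `η = −1` the phase of `Θ(ψ̄_f γ₅ ψ_g)`). -/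
theorem stub_transferPositivity : ∀ Nf : ℕ, APTI⟪Nf⟫ → TP⟪Nf⟫ := by
  intro Nf hAPTI β hβ S hS mq hm f g
  -- the universal constant `c₀` of site-reflection positivity on the torus `2S+1` and its phase
  obtain ⟨cN, hcNne, hcN⟩ := exists_fermiThetaRot_basis_posGens_ne (Nf := Nf) (L := 2 * S + 1) ⟨S, rfl⟩
  have hc₀ne : posConst (Nf := Nf) (L := 2 * S + 1) cN ≠ 0 := posConst_ne_zero hcNne
  set v : ℂ := conj (posConst (Nf := Nf) (L := 2 * S + 1) cN) / (‖posConst (Nf := Nf) (L := 2 * S + 1) cN‖ : ℂ)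
    with hv
  have hvn : ‖v‖ = 1 := norm_conj_div_norm hc₀ne
  have hT := hAPTI β S mq
  have hnorm : ∀ X : ℂ, ‖v * -X‖ = ‖X‖ := fun X => by rw [norm_mul, hvn, one_mul, norm_neg]
  have hre : ∀ X : ℂ, v * -X = -v * X := fun X => by ring
  refine ⟨-v, by rw [norm_neg, hvn], ?_, ?_⟩
  · -- (G1), (G2): the smeared Gram form on the span of `X_s`, `X_t`
    intro T h hTz s t hs hsS ht htS
    have hmem : ∀ r : ℕ, 1 ≤ r → r ≤ S → ∀ z ∈ T, Pi.single (0 : Fin 4) (r : ℤ) + z ∈ box 4 S := by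
      intro r hr hrS z hz
      rw [mem_box]
      intro i
      by_cases hi : i = 0
      · subst hi
        simp only [Pi.add_apply, Pi.single_eq_same, (hTz z hz).1, add_zero]
        omega
      · have h1 := abs_le.1 ((hTz z hz).2 i)
        simp only [Pi.add_apply, Pi.single_eq_of_ne hi, zero_add]
        exact h1
    set site : ℕ → Site 4 → ↥(box 4 S) := fun r z =>
      if hz : Pi.single (0 : Fin 4) (r : ℤ) + z ∈ box 4 S then ⟨_, hz⟩ else ⟨0, zero_mem_box 4 S⟩ with hsite_def
    have hsite : ∀ r : ℕ, 1 ≤ r → r ≤ S → ∀ z ∈ T,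
        ((site r z : ↥(box 4 S)) : Site 4) = Pi.single (0 : Fin 4) (r : ℤ) + z := by
      intro r hr hrS z hz
      rw [hsite_def]
      dsimp only
      rw [dif_pos (hmem r hr hrS z hz)]
    have htime : ∀ r : ℕ, 1 ≤ r → r ≤ S → ∀ z ∈ T, 1 ≤ ((site r z : ↥(box 4 S)) : Site 4) 0 := by
      intro r hr hrS z hz
      rw [hsite r hr hrS z hz]
      simp only [Pi.add_apply, Pi.single_eq_same, (hTz z hz).1, add_zero]
      exact_mod_cast hr
    -- the pairing sums are the smeared traces `𝒟_h(r + r')`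
    have hpair : ∀ r r' : ℕ, 1 ≤ r → r ≤ S → 1 ≤ r' → r' ≤ S →
        (∑ z ∈ T, ∑ z' ∈ T, ((h z * h z' : ℝ) : ℂ) *
          ∫ V : GaugeConfig 4 (2 * S + 1) SU3, fermiIntegral
            (torusBilinear g f (Torus.proj (2 * S + 1) 0) (Torus.proj (2 * S + 1) 0) gammaFive 1 *
              torusBilinear f g
                (Torus.proj (2 * S + 1) ↑(site r z) - Site.negReflect (Torus.proj (2 * S + 1) ↑(site r' z')))
                (Torus.proj (2 * S + 1) ↑(site r z) - Site.negReflect (Torus.proj (2 * S + 1) ↑(site r' z')))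
                gammaFive 1 * fermiBoltzmannAP V mq) ∂(wilsonMeasure (fundamentalRep (Fin 3)) β)) =
        dAP⟪β, S, mq, f, g, T, h, r + r'⟫ := by
      intro r r' hr hrS hr' hr'S
      rw [Finset.sum_congr rfl fun z hz => Finset.sum_congr rfl fun z' hz' => by
        rw [hsite r hr hrS z hz, hsite r' hr' hr'S z' hz', proj_sub_negReflect_proj _ _ _ _ _ (hTz z' hz').1]]
      have key := sum_sum_mul_swap T h (fun w => nAP⟪β, S, mq, f, g, (Pi.single (0 : Fin 4) (((r + r' : ℕ)) : ℤ) + w)⟫)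
      beta_reduce at key
      exact key
    obtain ⟨h11, h22, h12, -⟩ := gram_two_smul fun α β' =>
      gram_input_smeared hS mq hm hβ hcN f g T T h h (site s) (site t) (htime s hs hsS) (htime t ht htS) α β'
    simp only [pairing_smeared_eq hT] at h11 h22 h12
    rw [hpair s s hs hsS hs hsS] at h11 h12
    rw [hpair t t ht htS ht htS] at h22 h12
    rw [hpair s t hs hsS ht htS] at h12
    rw [two_mul s, two_mul t]
    refine ⟨?_, ?_⟩
    · rw [← hre]; exact h11
    · rw [hnorm, hre, hre] at h12
      exact h12
  · -- (G3): the Gram form of the two point densities at `(t, 0)` and `(t, w)`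
    intro t w ht htS hw0 hwS
    have hmem : ∀ z : Site 4, z 0 = 0 → (∀ i, |z i| ≤ (S : ℤ)) → Pi.single (0 : Fin 4) (t : ℤ) + z ∈ box 4 S := by
      intro z hz0 hzS
      rw [mem_box]
      intro i
      by_cases hi : i = 0
      · subst hi
        simp only [Pi.add_apply, Pi.single_eq_same, hz0, add_zero]
        omega
      · have h1 := abs_le.1 (hzS i)
        simp only [Pi.add_apply, Pi.single_eq_of_ne hi, zero_add]
        exact h1
    have h0mem := hmem 0 rfl (fun i => by simp)
    have hwmem := hmem w hw0 hwS
    have htime0 : (1 : ℤ) ≤ ((Pi.single (0 : Fin 4) (t : ℤ) + (0 : Site 4) : Site 4) 0) := by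
      simp only [Pi.add_apply, Pi.single_eq_same, Pi.zero_apply, add_zero]; exact_mod_cast ht
    have htimew : (1 : ℤ) ≤ ((Pi.single (0 : Fin 4) (t : ℤ) + w : Site 4) 0) := by
      simp only [Pi.add_apply, Pi.single_eq_same, hw0, add_zero]; exact_mod_cast ht
    obtain ⟨h11, -, -, h21⟩ := gram_two_smul fun α β' =>
      gram_input_smeared hS mq hm hβ hcN f g (Finset.univ : Finset Unit) (Finset.univ : Finset Unit)
        (fun _ => (1 : ℝ)) (fun _ => (1 : ℝ)) (fun _ => (⟨_, h0mem⟩ : ↥(box 4 S))) (fun _ => (⟨_, hwmem⟩ : ↥(box 4 S)))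
        (fun _ _ => htime0) (fun _ _ => htimew) α β'
    simp only [pairing_smeared_eq hT] at h11 h21
    simp only [Finset.univ_unique, Finset.sum_singleton, mul_one, Complex.ofReal_one, one_mul] at h11 h21
    rw [proj_sub_negReflect_proj (2 * S + 1) t t 0 0 rfl] at h11 h21
    rw [proj_sub_negReflect_proj (2 * S + 1) t t w 0 rfl, proj_sub_negReflect_proj (2 * S + 1) t t w w hw0] at h21
    simp only [sub_zero, sub_self, add_zero] at h11 h21
    rw [two_mul t]
    rw [hnorm, hre] at h21
    rw [hre] at h11
    exact norm_le_re_of_sq_le h11 h21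

end Summit.QuantumFields.QCD.Cruxes.ChiralOneScaleTrajectory.LogConvexLift.TransferPositivity

end
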